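import Mathlib
import Summits.NavierStokesRegularity.NavierStokesRegularity.Theorems.FilamentSkeletonRssStadiumCornerRightDescentFar

/-!
# Route `FilamentSkeletonRss` · child crux `TangentSkeletonNearStraightL` (stmt-NavierStokesRegularity-23320) · registered line
# `child_tangent_analytic_strip_L` (b0b56c52900dd90a), stub `stub_stripPropagation` — assembly: FAR SOURCES (THE OTHER END OF THE CONTOUR), WITH NUMBERS

Completes the pointwise cover of the quarter-width contour (evidence `CORNER-QUARTER-BLUEPRINT-leafhand-15-g0.md` v5 on 23320 + this hand's
census): for a target `z = x₀ + iY` (`0 ≤ Y < hs/4`, target-leg radius `3hs/4` admissible) EVERY source `ζ = (x₀ + a) + iη` with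
`a ≥ hs`, `0 ≤ η ≤ Y` and room `hs/2` at its foot (`|x₀ + a − cc| + hs/2 < L + hs`) is on the principal branch (`far_source_re_pos`), by the
two-feet estimate in general position (`two_feet_re_pos_of_num`: free admissible source-leg radius, target anywhere in the stadium) with
`R₂ = hs/2`, `ηs = hs/4`, `Ss = (hs/4)²`, `log 2 ≥ 0.6931`, `√3 ≤ 1.73206`: margin `0.14·hs + (7/8)(a − hs)`.  These are the sources of the
long plateau's end and of the OTHER end's descent (distance `≥ L ≫ hs` from any target near this end); sources to the LEFT of the target are
the same statement for the reflected data (`Theorems.StadiumCornerTransport`, `Theorems.StadiumCornerConj`).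
HONEST FRAMING: bookkeeping for a HYPOTHETICAL filament skeleton on the NEGATIVE side of a MODEL route; the stub `stub_stripPropagation` is NOT
closed by this file; nothing here bears on Navier–Stokes regularity or blow-up.  `--supports stmt-NavierStokesRegularity-23320`.
-/

set_option linter.dupNamespace false

noncomputable section

namespace Summit.NavierStokesRegularity.NavierStokesRegularity.Theorems.StadiumCornerFarSource

open Set MeasureTheory
open scoped InnerProductSpace BigOperators
open Summit.NavierStokesRegularity.NavierStokesRegularity.Theorems.StadiumCornerRightFoot
open Summit.NavierStokesRegularity.NavierStokesRegularity.Theorems.StadiumCornerRightDescentFoot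
open Summit.NavierStokesRegularity.NavierStokesRegularity.Theorems.StadiumCornerRightDescentFar
open Summit.NavierStokesRegularity.NavierStokesRegularity.Theorems.StadiumFootClosedForm
open Summit.NavierStokesRegularity.NavierStokesRegularity.Theorems.StadiumChordProjection

/-- **The two-feet estimate for a source to the right of the target, reduced to one number (general position).**  Stadium `S = {|Im| < hs, |Re − cc| < L + hs}`,
`F` holomorphic on `S` with `‖F′‖ ≤ 2`, `Σ (F′)ᵢ² = 1`, `F = cplx ∘ X` on the real trace, `X` of class `C¹` with unit speed and tangent
oscillation `≤ Rb ≤ 1/2`; target `z = x₀ + iY` (`0 ≤ Y < hs/4`, target-leg radius `3hs/4` admissible: `|x₀ − cc| + 3hs/4 < L + hs`); source `ζ = (x₀ + a) + iη` with `0 < a`,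
`0 ≤ η ≤ ηs < 3hs/4 − a =: R₂`; a bound `(Y−η)² + Yη/4 ≤ Ss`; core term `0 < κ`, `0 < g₀ ≤ Re G`.  If
`√Ss + 0.0389hs + √3·4(ηs − (R₂−ηs)ℓ − ηs²/(2R₂)) < (7/8)a − 0.0398hs − 24·K(R₂,ηs) − ½·√3·2(ηs − (R₂−ηs)ℓ)` (`ℓ = log(R₂/(R₂−ηs))`,
`K` the `J`-closed form), then `0 < Re(Σᵢ (Fᵢ(ζ) − Fᵢ(z))² + κ·G)`. [folklore] -/
theorem two_feet_re_pos_of_num {hs L cc : ℝ} {F : ℂ → (Fin 3 → ℂ)}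
    (hF : DifferentiableOn ℂ F {z : ℂ | |z.im| < hs ∧ |z.re - cc| < L + hs})
    (hM : ∀ z ∈ {z : ℂ | |z.im| < hs ∧ |z.re - cc| < L + hs}, ‖deriv F z‖ ≤ 2)
    (hunit : ∀ w ∈ {z : ℂ | |z.im| < hs ∧ |z.re - cc| < L + hs}, ∑ i, (deriv F w i) ^ 2 = 1)
    {X : ℝ → EuclideanSpace ℝ (Fin 3)} (hX : ContDiff ℝ 1 X) (hXu : ∀ τ, ‖deriv X τ‖ = 1)
    {Rb : ℝ} (hRb0 : 0 ≤ Rb) (hRb : Rb ≤ 1 / 2) (hosc : ∀ τ σ, ‖deriv X τ - deriv X σ‖ ≤ Rb)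
    (hFX : ∀ r : ℝ, (r : ℂ) ∈ {z : ℂ | |z.im| < hs ∧ |z.re - cc| < L + hs} →
      F r = fun i => ((⟪X r, EuclideanSpace.single i (1:ℝ)⟫_ℝ : ℝ) : ℂ))
    (hhs : 0 < hs) {x₀ Y a η ηs Ss R₂ : ℝ} (hY0 : 0 ≤ Y) (hY : Y < hs / 4) (hR₁end : |x₀ - cc| + 3 * hs / 4 < L + hs)
    (ha0 : 0 < a) (hR₂pos : 0 < R₂) (hR₂hs : R₂ < hs) (hR₂end : |x₀ + a - cc| + R₂ < L + hs) (hη0 : 0 ≤ η) (hηs : η ≤ ηs) (hηsR : ηs < R₂)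
    (hSs : (Y - η) ^ 2 + Y * η / 4 ≤ Ss)
    (hnum : √Ss + 0.0389 * hs +
        √3 * (2 * 2 * (ηs - (R₂ - ηs) * Real.log (R₂ / (R₂ - ηs)) -
          ηs ^ 2 / (2 * R₂))) <
      7 / 8 * a - 0.0398 * hs -
        (6 * (2:ℝ) ^ 2 * (2 * ηs - (R₂ - ηs) * Real.log (R₂ / (R₂ - ηs)) ^ 2 -
            2 * (R₂ - ηs) * Real.log (R₂ / (R₂ - ηs)) +
            (R₂ ^ 2 - ηs ^ 2) * Real.log (R₂ / (R₂ - ηs)) / (2 * R₂) -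
            ηs / 2 - ηs ^ 2 / (4 * R₂)) +
          1 / 2 * (√3 * (2 * (ηs - (R₂ - ηs) * Real.log (R₂ / (R₂ - ηs)))))))
    {κ g₀ : ℝ} {Gv : ℂ} (hκ : 0 < κ) (hg₀ : 0 < g₀) (hG : g₀ ≤ Gv.re) :
    0 < ((∑ i, (F (((x₀ + a : ℝ) : ℂ) + (η : ℂ) * Complex.I) i - F ((x₀ : ℂ) + (Y : ℂ) * Complex.I) i) ^ 2) +
      (κ : ℂ) * Gv).re := by
  have hXd : Differentiable ℝ X := hX.differentiable (by norm_num)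
  -- the mixed term (small context first)
  have hRb2 : Rb ^ 2 ≤ 1 / 4 := by nlinarith
  have hmix : √((Y - η) ^ 2 + Y * η * Rb ^ 2) ≤ √Ss := by
    apply Real.sqrt_le_sqrt
    have hYη : 0 ≤ Y * η := mul_nonneg hY0 hη0
    have h1 : Y * η * Rb ^ 2 ≤ Y * η * (1 / 4) := mul_le_mul_of_nonneg_left hRb2 hYη
    linarith only [h1, hSs]
  have hmix0 : 0 ≤ √((Y - η) ^ 2 + Y * η * Rb ^ 2) := Real.sqrt_nonneg _
  -- radii
  have hR₁Y : Y < 3 * hs / 4 := by linarith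
  have hR₁hs : 3 * hs / 4 < hs := by linarith
  have hηR₂ : η < R₂ := lt_of_le_of_lt hηs hηsR
  have hηs0 : 0 ≤ ηs := hη0.trans hηs
  -- chord projection `c₀ = (1 − Rb²/2)·a ≥ (7/8)a`
  have hc₀ := chord_proj_coords_ge hX hXu hosc (x₁ := x₀) (x₂ := x₀ + a) (by linarith)
  have hc₀' : 7 / 8 * a ≤ (1 - Rb ^ 2 / 2) * (x₀ + a - x₀) := by
    have e : x₀ + a - x₀ = a := by ring
    rw [e]
    have h1 : 7 / 8 ≤ 1 - Rb ^ 2 / 2 := by nlinarith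
    nlinarith
  -- target leg numbers
  have hI₁ := corner_I_le hhs hY0 hY.le
  have hJ₁ := corner_J_le hhs hY0 hY.le
  have hI₁0 : 0 ≤ √3 * (2 * 2 * (Y - (3 * hs / 4 - Y) * Real.log (3 * hs / 4 / (3 * hs / 4 - Y)) - Y ^ 2 / (2 * (3 * hs / 4)))) := by
    have h := legI_closed_mono (M := 2) (R := 3 * hs / 4) (t₁ := 0) (t₂ := Y) (by norm_num) le_rfl hY0 hR₁Y
    have e : √3 * (2 * 2 * (0 - (3 * hs / 4 - 0) * Real.log (3 * hs / 4 / (3 * hs / 4 - 0)) - 0 ^ 2 / (2 * (3 * hs / 4)))) = 0 := by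
      rw [sub_zero, div_self (by positivity : (3 * hs / 4) ≠ 0), Real.log_one]; ring
    rw [e] at h
    exact h
  -- source leg: monotone in the height up to `ηs`
  have hI₂ := legI_closed_mono (M := 2) (R := R₂) (by norm_num) hη0 hηs hηsR
  have hI₂0 : 0 ≤ √3 * (2 * 2 * (η - (R₂ - η) * Real.log (R₂ / (R₂ - η)) -
      η ^ 2 / (2 * R₂))) := by
    have h := legI_closed_mono (M := 2) (R := R₂) (t₁ := 0) (t₂ := η) (by norm_num) le_rfl hη0 hηR₂
    have e : √3 * (2 * 2 * (0 - (R₂ - 0) * Real.log (R₂ / (R₂ - 0)) -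
        0 ^ 2 / (2 * R₂))) = 0 := by
      rw [sub_zero, div_self (ne_of_gt hR₂pos), Real.log_one]; ring
    rw [e] at h
    exact h
  have hJ₂ := legJ_closed_mono (M := 2) (R := R₂) hη0 hηs hηsR
  have hQ₂ := legQ_closed_mono (M := 2) (R := R₂) (by norm_num) hη0 hηs hηsR
  have hQ₂0 : 0 ≤ √3 * (2 * (η - (R₂ - η) * Real.log (R₂ / (R₂ - η)))) := by
    have h := legQ_closed_mono (M := 2) (R := R₂) (t₁ := 0) (t₂ := η) (by norm_num) le_rfl hη0 hηR₂
    have e : √3 * (2 * (0 - (R₂ - 0) * Real.log (R₂ / (R₂ - 0)))) = 0 := by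
      rw [sub_zero, div_self (ne_of_gt hR₂pos), Real.log_one]; ring
    rw [e] at h
    exact h
  -- atomise all closed forms
  generalize hCv : (1 - Rb ^ 2 / 2) * (x₀ + a - x₀) = Cv at hc₀ hc₀'
  generalize hJ1v : 6 * (2:ℝ) ^ 2 * (2 * Y - (3 * hs / 4 - Y) * Real.log (3 * hs / 4 / (3 * hs / 4 - Y)) ^ 2 -
        2 * (3 * hs / 4 - Y) * Real.log (3 * hs / 4 / (3 * hs / 4 - Y)) +
        ((3 * hs / 4) ^ 2 - Y ^ 2) * Real.log (3 * hs / 4 / (3 * hs / 4 - Y)) / (2 * (3 * hs / 4)) - Y / 2 -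
        Y ^ 2 / (4 * (3 * hs / 4))) = J1v at hJ₁
  generalize hI1v : √3 * (2 * 2 * (Y - (3 * hs / 4 - Y) * Real.log (3 * hs / 4 / (3 * hs / 4 - Y)) -
      Y ^ 2 / (2 * (3 * hs / 4)))) = I1v at hI₁ hI₁0
  generalize hJ2v : 6 * (2:ℝ) ^ 2 * (2 * η - (R₂ - η) * Real.log (R₂ / (R₂ - η)) ^ 2 -
        2 * (R₂ - η) * Real.log (R₂ / (R₂ - η)) +
        (R₂ ^ 2 - η ^ 2) * Real.log (R₂ / (R₂ - η)) / (2 * R₂) -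
        η / 2 - η ^ 2 / (4 * R₂)) = J2v at hJ₂
  generalize hJ2s : 6 * (2:ℝ) ^ 2 * (2 * ηs - (R₂ - ηs) * Real.log (R₂ / (R₂ - ηs)) ^ 2 -
        2 * (R₂ - ηs) * Real.log (R₂ / (R₂ - ηs)) +
        (R₂ ^ 2 - ηs ^ 2) * Real.log (R₂ / (R₂ - ηs)) / (2 * R₂) -
        ηs / 2 - ηs ^ 2 / (4 * R₂)) = J2s at hJ₂ hnum
  generalize hI2v : √3 * (2 * 2 * (η - (R₂ - η) * Real.log (R₂ / (R₂ - η)) -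
      η ^ 2 / (2 * R₂))) = I2v at hI₂ hI₂0
  generalize hI2s : √3 * (2 * 2 * (ηs - (R₂ - ηs) * Real.log (R₂ / (R₂ - ηs)) -
      ηs ^ 2 / (2 * R₂))) = I2s at hI₂ hnum
  generalize hQ2v : √3 * (2 * (η - (R₂ - η) * Real.log (R₂ / (R₂ - η)))) = Q2v at hQ₂ hQ₂0
  generalize hQ2s : √3 * (2 * (ηs - (R₂ - ηs) * Real.log (R₂ / (R₂ - ηs)))) = Q2s
    at hQ₂ hnum
  generalize hMv : √((Y - η) ^ 2 + Y * η * Rb ^ 2) = Mv at hmix hmix0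
  -- the Rb-term of `J₂`
  have hRbQ : Rb * Q2v ≤ 1 / 2 * Q2s := by
    calc Rb * Q2v ≤ Rb * Q2s := mul_le_mul_of_nonneg_left hQ₂ hRb0
      _ ≤ 1 / 2 * Q2s := mul_le_mul_of_nonneg_right hRb (hQ₂0.trans hQ₂)
  have hRbQ0 : 0 ≤ Rb * Q2v := mul_nonneg hRb0 hQ₂0
  have hJ₂0' : J2v ≤ J2s := hJ₂
  -- the gap
  have hSs0 : 0 ≤ √Ss := Real.sqrt_nonneg _
  have ha' : 0 ≤ Cv - J1v - (J2v + Rb * Q2v) := by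
    linarith only [hSs0, hnum, hc₀', hJ₁, hJ₂0', hRbQ, hI₁0, hI₂0, hI₂, hhs]
  have h := foot_re_ge_closed_form (M := 2) hF hM hunit hXd hXu hosc hFX hhs hY0 hη0 hR₁Y hR₁hs hR₁end hηR₂ hR₂hs hR₂end hc₀
    (by rw [hJ1v, hJ2v, hQ2v]; exact ha')
  rw [hJ1v, hJ2v, hQ2v, hI1v, hI2v, hMv] at h
  have hB0 : 0 ≤ Mv + I1v + I2v := by linarith only [hmix0, hI₁0, hI₂0]
  have hgap : Mv + I1v + I2v < Cv - J1v - (J2v + Rb * Q2v) := by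
    linarith only [hSs0, hnum, hc₀', hJ₁, hJ₂0', hRbQ, hI₁, hI₂, hmix, hhs]
  have hsq : 0 < (Cv - J1v - (J2v + Rb * Q2v)) ^ 2 - (Mv + I1v + I2v) ^ 2 := by
    have e : (Cv - J1v - (J2v + Rb * Q2v)) ^ 2 - (Mv + I1v + I2v) ^ 2 =
        ((Cv - J1v - (J2v + Rb * Q2v)) - (Mv + I1v + I2v)) * ((Cv - J1v - (J2v + Rb * Q2v)) + (Mv + I1v + I2v)) := by ring
    rw [e]
    exact mul_pos (by linarith only [hgap]) (by linarith only [hgap, hB0])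
  -- orientation of the chord and the core term
  have hsym : (∑ i, (F (((x₀ + a : ℝ) : ℂ) + (η : ℂ) * Complex.I) i - F ((x₀ : ℂ) + (Y : ℂ) * Complex.I) i) ^ 2) =
      ∑ i, (F ((x₀ : ℂ) + (Y : ℂ) * Complex.I) i - F (((x₀ + a : ℝ) : ℂ) + (η : ℂ) * Complex.I) i) ^ 2 :=
    Finset.sum_congr rfl fun i _ => by ring
  rw [Complex.add_re, hsym]
  have hκG : 0 < ((κ : ℂ) * Gv).re := by
    rw [Complex.re_ofReal_mul]
    exact mul_pos hκ (lt_of_lt_of_le hg₀ hG)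
  push_cast at h ⊢
  linarith only [h, hsq, hκG]


/-- **Far sources, with numbers.**  Stadium `S = {|Im| < hs, |Re − cc| < L + hs}`, `F` holomorphic on `S` with `‖F′‖ ≤ 2`, `Σ (F′)ᵢ² = 1`,
`F = cplx ∘ X` on the real trace, `X` of class `C¹` with unit speed and tangent oscillation `≤ Rb ≤ 1/2`; target `z = x₀ + iY` with
`0 ≤ Y < hs/4` and `|x₀ − cc| + 3hs/4 < L + hs`; source `ζ = (x₀ + a) + iη` with `a ≥ hs`, `0 ≤ η ≤ Y`, `|x₀ + a − cc| + hs/2 < L + hs`;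
core term `0 < κ`, `0 < g₀ ≤ Re G`.  Then `0 < Re(Σᵢ (Fᵢ(ζ) − Fᵢ(z))² + κ·G)`. [folklore] -/
theorem far_source_re_pos {hs L cc : ℝ} {F : ℂ → (Fin 3 → ℂ)}
    (hF : DifferentiableOn ℂ F {z : ℂ | |z.im| < hs ∧ |z.re - cc| < L + hs})
    (hM : ∀ z ∈ {z : ℂ | |z.im| < hs ∧ |z.re - cc| < L + hs}, ‖deriv F z‖ ≤ 2)
    (hunit : ∀ w ∈ {z : ℂ | |z.im| < hs ∧ |z.re - cc| < L + hs}, ∑ i, (deriv F w i) ^ 2 = 1)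
    {X : ℝ → EuclideanSpace ℝ (Fin 3)} (hX : ContDiff ℝ 1 X) (hXu : ∀ τ, ‖deriv X τ‖ = 1)
    {Rb : ℝ} (hRb0 : 0 ≤ Rb) (hRb : Rb ≤ 1 / 2) (hosc : ∀ τ σ, ‖deriv X τ - deriv X σ‖ ≤ Rb)
    (hFX : ∀ r : ℝ, (r : ℂ) ∈ {z : ℂ | |z.im| < hs ∧ |z.re - cc| < L + hs} →
      F r = fun i => ((⟪X r, EuclideanSpace.single i (1:ℝ)⟫_ℝ : ℝ) : ℂ))
    (hhs : 0 < hs) {x₀ Y a η : ℝ} (hY0 : 0 ≤ Y) (hY : Y < hs / 4) (hR₁end : |x₀ - cc| + 3 * hs / 4 < L + hs)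
    (ha : hs ≤ a) (hη0 : 0 ≤ η) (hηY : η ≤ Y) (hR₂end : |x₀ + a - cc| + hs / 2 < L + hs)
    {κ g₀ : ℝ} {Gv : ℂ} (hκ : 0 < κ) (hg₀ : 0 < g₀) (hG : g₀ ≤ Gv.re) :
    0 < ((∑ i, (F (((x₀ + a : ℝ) : ℂ) + (η : ℂ) * Complex.I) i - F ((x₀ : ℂ) + (Y : ℂ) * Complex.I) i) ^ 2) +
      (κ : ℂ) * Gv).re := by
  have ha0 : 0 < a := lt_of_lt_of_le hhs ha
  have hR₂pos : 0 < hs * (1 / 2) := by positivity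
  have hR₂hs : hs * (1 / 2) < hs := by linarith
  have hR₂end' : |x₀ + a - cc| + hs * (1 / 2) < L + hs := by linarith
  have hηs : η ≤ hs * (1 / 4) := by linarith
  have hηsR : hs * (1 / 4) < hs * (1 / 2) := by linarith
  have hSs : (Y - η) ^ 2 + Y * η / 4 ≤ (1 / 4 * hs) ^ 2 := by
    have h1 : (Y - η) ^ 2 + Y * η / 4 ≤ Y ^ 2 := by nlinarith
    have h2 : Y ^ 2 ≤ (hs / 4) ^ 2 := pow_le_pow_left₀ hY0 hY.le 2
    nlinarith
  refine two_feet_re_pos_of_num hF hM hunit hX hXu hRb0 hRb hosc hFX hhs hY0 hY hR₁end ha0 hR₂pos hR₂hs hR₂end' hη0 hηs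
    hηsR hSs ?_ hκ hg₀ hG
  -- decimals: `r = 1/2`, `e = 1/4`, `ℓ = log 2 ≥ 0.6931`, `q = 1/4`
  have hlog : Real.log (hs * (1 / 2) / (hs * (1 / 2) - hs * (1 / 4))) = Real.log ((1 / 2 : ℝ) / (1 / 2 - 1 / 4)) := by
    rw [← mul_sub, mul_div_mul_left _ _ hhs.ne']
  have hsq : √((1 / 4 * hs) ^ 2) = 1 / 4 * hs := Real.sqrt_sq (by positivity)
  rw [hlog, hsq]
  have hℓ : (0.6931 : ℝ) ≤ Real.log ((1 / 2 : ℝ) / (1 / 2 - 1 / 4)) := by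
    rw [show (1 / 2 : ℝ) / (1 / 2 - 1 / 4) = 2 by norm_num]
    have := Real.log_two_gt_d9
    linarith
  have hred := foot_reduce (r := 1 / 2) (e := 1 / 4) (ℓ₀ := 0.6931) (P := 1 / 4 + 0.0389) (M := 7 / 8 - 0.0398)
    (by norm_num) (by norm_num) (by norm_num) hℓ (by norm_num) (by norm_num)
  generalize hℓv : Real.log ((1 / 2 : ℝ) / (1 / 2 - 1 / 4)) = ℓ at hred ⊢
  have e1 : (hs * (1 / 4)) ^ 2 / (2 * (hs * (1 / 2))) = hs * ((1 / 4 : ℝ) ^ 2 / (2 * (1 / 2))) := by field_simp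
  have e2 : ((hs * (1 / 2)) ^ 2 - (hs * (1 / 4)) ^ 2) * ℓ / (2 * (hs * (1 / 2))) =
      hs * (((1 / 2 : ℝ) ^ 2 - (1 / 4) ^ 2) * ℓ / (2 * (1 / 2))) := by field_simp
  have e3 : (hs * (1 / 4)) ^ 2 / (4 * (hs * (1 / 2))) = hs * ((1 / 4 : ℝ) ^ 2 / (4 * (1 / 2))) := by field_simp
  rw [e1, e2, e3]
  have h1 := mul_lt_mul_of_pos_left hred hhs
  have ha1 : hs * (7 / 8 - 0.0398) ≤ 7 / 8 * a - 0.0398 * hs := by linarith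
  linarith only [h1, ha1]

end Summit.NavierStokesRegularity.NavierStokesRegularity.Theorems.StadiumCornerFarSource

end
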